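import Summits.FinalStateConjecture.FinalStateConjecture.Theorems.StarvedNecksHonestFixedRadiusSettlingStubFarExitKinematics
import Literature.Geometry.Lorentzian.KerrConvergence
import Literature.Geometry.Lorentzian.KerrSchildEnergyEstimate

/-!
# Crux `HonestFixedRadiusSettling` · line `sojourn-needs-only-one-over-delta` · stub `stub_farExit`
# Layer H3 (b): assembly lemmas — the exact flat zone, tube separation, momentum conservation

Helper file for `stmt-FinalStateConjecture-13550` (stub `stub_farExit`). Bookkeeping lemmas phrased
over the clauses of the one-atlas predicate that the far-exit transport consumes:
* the EXACT FLAT ZONE `Z = {y | −1 < y⁰, R♯(y⁰) < ‖y⃗‖}`: open (`isOpen_zone`), its closure lies in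
  `{−1 ≤ y⁰, R♯(y⁰) ≤ ‖y⃗‖}` and in the far zone `‖y⃗‖ ≥ 16M + |a| + 1` (FLOOR), and a closure point
  not in `Z` with `y⁰ > −1` sits ON the inner boundary `‖y⃗‖ = R♯(y⁰)` (`spatialNorm_eq_of_frontier`);
* SEPARATED ⇒ a late inner-boundary point lies in the flat domain (`mem_flatDomain_of_boundary`:
  inside a flat tube one would have `κ y⁰ ≤ 0`);
* `momentum_const`: along a chart curve whose momentum `p₀ = G♭(z)(ż, e₀)` obeys the Euler–Lagrange
  equation `ṗ₀ = ½ ∂₀G♭(z)(ż, ż)`, and which stays in an open set where `G♭` agrees with STATIONARY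
  components `G` (`∂₀ G = 0`), the Killing energy `−p₀` is conserved;
* `eq_of_eqOn_Ico`, `late_conclusion`: one-line real-analysis conveniences.

References: B. O'Neill, *Semi-Riemannian geometry* (1983), Ch. 3, Prop. 13 and Cor. 21, Ch. 9,
Prop. 25 (Killing energy); M. Dafermos, I. Rodnianski, arXiv:0811.0354, §5.1.
-/

set_option linter.dupNamespace false

noncomputable section

open Literature.Geometry.Lorentzian
open scoped Manifold ContDiff Topology
open Filter Set Metric

namespace Summit.FinalStateConjecture.FinalStateConjecture.Theorems.StarvedNecks.OneOverDelta.Assembly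

open Summit.FinalStateConjecture.FinalStateConjecture.Theorems.StarvedNecks.OneOverDelta.Kinematics

/-! ## The exact flat zone -/

section Zone

variable {M a : ℝ} {Rs : ℝ → ℝ}

/-- The exact flat zone `{−1 < y⁰, R♯(y⁰) < ‖y⃗‖}` is open. [folklore] -/
theorem isOpen_zone (hRs : Continuous Rs) :
    IsOpen {y : E4 | -1 < y 0 ∧ Rs (y 0) < E4.spatialNorm y} := by
  have hc0 : Continuous fun y : E4 ↦ y 0 := (EuclideanSpace.proj (0 : Fin 4) : E4 →L[ℝ] ℝ).continuous
  exact (isOpen_lt continuous_const hc0).inter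
    (isOpen_lt (hRs.comp hc0) E4.continuous_spatialNorm)

/-- The closure of the exact flat zone lies in `{−1 ≤ y⁰, R♯(y⁰) ≤ ‖y⃗‖}`. [folklore] -/
theorem closure_zone_subset (hRs : Continuous Rs) :
    closure {y : E4 | -1 < y 0 ∧ Rs (y 0) < E4.spatialNorm y} ⊆
      {y : E4 | -1 ≤ y 0 ∧ Rs (y 0) ≤ E4.spatialNorm y} := by
  have hc0 : Continuous fun y : E4 ↦ y 0 := (EuclideanSpace.proj (0 : Fin 4) : E4 →L[ℝ] ℝ).continuous
  refine closure_minimal (fun y hy ↦ ⟨hy.1.le, hy.2.le⟩) ?_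
  exact (isClosed_le continuous_const hc0).inter
    (isClosed_le (hRs.comp hc0) E4.continuous_spatialNorm)

/-- FLOOR: closure points of the exact flat zone are far, `‖y⃗‖ ≥ 16M + |a| + 1`. [folklore] -/
theorem far_of_mem_closure_zone (hRs : Continuous Rs) (hfloor : ∀ t, 16 * M + |a| + 1 ≤ Rs t) {y : E4}
    (hy : y ∈ closure {y : E4 | -1 < y 0 ∧ Rs (y 0) < E4.spatialNorm y}) :
    16 * M + |a| + 1 ≤ E4.spatialNorm y :=
  (hfloor (y 0)).trans (closure_zone_subset hRs hy).2

/-- A closure point of the zone which is not in the zone and has `y⁰ > −1` lies ON the inner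
boundary: `‖y⃗‖ = R♯(y⁰)`. [folklore] -/
theorem spatialNorm_eq_of_frontier (hRs : Continuous Rs) {y : E4}
    (hy : y ∈ closure {y : E4 | -1 < y 0 ∧ Rs (y 0) < E4.spatialNorm y})
    (hyZ : y ∉ {y : E4 | -1 < y 0 ∧ Rs (y 0) < E4.spatialNorm y}) (hy0 : -1 < y 0) :
    E4.spatialNorm y = Rs (y 0) := by
  have h1 := (closure_zone_subset hRs hy).2
  have h2 : ¬ Rs (y 0) < E4.spatialNorm y := fun h ↦ hyZ ⟨hy0, h⟩
  linarith [not_lt.1 h2]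

end Zone

/-! ## SEPARATED: late inner-boundary points are flat points -/

/-- **SEPARATED ⇒ the inner boundary is charted late.** If every flat-tube point `z` (after `τ₀`)
has `‖z⃗‖ + κ z⁰ ≤ R♯(z⁰)` with `κ > 0`, then a point `y` with `‖y⃗‖ = R♯(y⁰)`, `y⁰ > τ₀` and
`y⁰ > 0` lies outside every tube, hence in the flat domain
(`FinalStateDecomposition.setOf_lt_excision_subset_flatDomain`). [folklore] -/
theorem mem_flatDomain_of_boundary {𝓢 : Spacetime 4} {O : Set 𝓢.carrier} {k : ℕ}
    (d : FinalStateDecomposition 𝓢 O k) {Rs : ℝ → ℝ} {κ : ℝ} (hκ : 0 < κ)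
    (hSep : ∀ (i : Fin d.N) (z : E4), d.τ₀ ≤ z 0 →
      Kerr.radius (d.spin i) (poincareInv (d.motion i).1 (d.motion i).2 z) ≤ d.excision i (z 0) →
        E4.spatialNorm z + κ * z 0 ≤ Rs (z 0))
    {y : E4} (hyR : E4.spatialNorm y = Rs (y 0)) (hτ₀ : d.τ₀ < y 0) (hy0 : 0 < y 0) :
    y ∈ (d.flatDomain : Set E4) := by
  refine d.setOf_lt_excision_subset_flatDomain ⟨hτ₀, fun i ↦ ?_⟩
  by_contra h
  have := hSep i y hτ₀.le (not_lt.1 h)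
  nlinarith [mul_pos hκ hy0]

/-! ## Conservation of the Killing energy along the chart curve -/

/-- **Momentum conservation.** Let `G♭, G` be fields of bilinear forms agreeing on an open set `Z`,
with `G` stationary in the sense `∂₀ G ≡ 0`. If along a curve `(z, ż)` the momentum
`p₀(t) = G♭(z t)(ż t, e₀)` satisfies the Euler–Lagrange equation
`ṗ₀(t) = ½ ∂₀ G♭(z t)(ż t, ż t)` on a convex parameter set `S` on which `z ∈ Z`, then `p₀` is
constant on `S`. [cite: ONeill1983, Ch. 9, Prop. 25] -/
theorem momentum_const {Gc G : E4 → E4 →L[ℝ] E4 →L[ℝ] ℝ} {Z : Set E4} (hZ : IsOpen Z)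
    (hGZ : ∀ y ∈ Z, Gc y = G y) (hG0 : ∀ y, fderiv ℝ G y (E4.basisVector 0) = 0)
    {z ż : ℝ → E4} {S : Set ℝ} (hS : Convex ℝ S)
    (hmom : ∀ t ∈ S, HasDerivAt (fun s ↦ Gc (z s) (ż s) (E4.basisVector 0))
      ((2 : ℝ)⁻¹ * fderiv ℝ Gc (z t) (E4.basisVector 0) (ż t) (ż t)) t)
    (hzZ : ∀ t ∈ S, z t ∈ Z) {s t : ℝ} (hs : s ∈ S) (ht : t ∈ S) :
    Gc (z t) (ż t) (E4.basisVector 0) = Gc (z s) (ż s) (E4.basisVector 0) := by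
  have hder : ∀ r ∈ S, HasDerivWithinAt (fun s ↦ Gc (z s) (ż s) (E4.basisVector 0)) 0 S r := by
    intro r hr
    have hev : Gc =ᶠ[𝓝 (z r)] G := Filter.eventuallyEq_of_mem (hZ.mem_nhds (hzZ r hr)) hGZ
    have h1 := hmom r hr
    rw [hev.fderiv_eq, hG0 (z r)] at h1
    simp at h1
    exact h1.hasDerivWithinAt
  have key := hS.norm_image_sub_le_of_norm_hasDerivWithin_le (C := 0) hder (fun _ _ ↦ by simp) hs ht
  rw [zero_mul, norm_le_zero_iff, sub_eq_zero] at key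
  exact key

/-- A real function constant on `[0, T)` and continuous at `T > 0` takes the same value at `T`.
[folklore] -/
theorem eq_of_eqOn_Ico {f : ℝ → ℝ} {c T : ℝ} (hT : 0 < T) (hf : ContinuousAt f T)
    (h : ∀ t ∈ Ico 0 T, f t = c) : f T = c := by
  have hmem : T ∈ closure (Ico 0 T) := by rw [closure_Ico hT.ne]; exact ⟨hT.le, le_rfl⟩
  haveI : (𝓝[Ico 0 T] T).NeBot := mem_closure_iff_nhdsWithin_neBot.1 hmem
  have h1 : Tendsto f (𝓝[Ico 0 T] T) (𝓝 (f T)) := hf.tendsto.mono_left nhdsWithin_le_nhds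
  have h2 : Tendsto f (𝓝[Ico 0 T] T) (𝓝 c) :=
    (tendsto_const_nhds (x := c)).congr' (eventually_nhdsWithin_of_forall fun t ht ↦ (h t ht).symm)
  exact tendsto_nhds_unique h1 h2

/-- The lateness bookkeeping: `5 (‖x‖ − R♯ 0) ≤ 16 y⁰` with `‖x‖ > R♯ 0 + 4 (|τ| + |τ₀| + 1)` gives
`τ ≤ y⁰`, `τ₀ < y⁰`, `0 < y⁰`. [folklore] -/
theorem late_conclusion {nx R0 y0 τ τ₀ : ℝ} (h : 5 * (nx - R0) ≤ 16 * y0)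
    (hx : R0 + 4 * (|τ| + |τ₀| + 1) < nx) : τ ≤ y0 ∧ τ₀ < y0 ∧ 0 < y0 := by
  have h1 := le_abs_self τ
  have h2 := le_abs_self τ₀
  have h3 := abs_nonneg τ
  have h4 := abs_nonneg τ₀
  refine ⟨by linarith, by linarith, by linarith⟩

/-- **Deciding theorem of this helper file (registered stub `farExit_late_conclusion`)**: the lateness
bookkeeping with explicit binders. [folklore] -/
theorem farExit_late_conclusion : ∀ (nx R0 y0 τ τ₀ : ℝ), 5 * (nx - R0) ≤ 16 * y0 → R0 + 4 * (|τ| + |τ₀| + 1) < nx → τ ≤ y0 ∧ τ₀ < y0 ∧ 0 < y0 :=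
  fun _ _ _ _ _ h hx ↦ late_conclusion h hx

end Summit.FinalStateConjecture.FinalStateConjecture.Theorems.StarvedNecks.OneOverDelta.Assembly

end
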